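import Summits.AnomalousDissipation.AnomalousDissipation.Theorems.BaireTransferRobustLoudUpgradeStubLsFamilyB
import Summits.AnomalousDissipation.AnomalousDissipation.Theorems.BaireTransferRobustLoudUpgradePeriodicPersistOfHenry

/-!
# Stub `stub_borderedFamily` of the line `malkin-cone-group-orbits` (crux stmt-AnomalousDissipation-1144, skeleton v5):
# the bordered implicit family at a simply degenerate steady state with ONE visible force direction

Registered stub (Pi-form), proved here as a COROLLARY of the landed, more general `LsFamily.stub_lsFamily`
(`…StubLsFamilyB.lean`): at a mean-zero classical steady state `u₀` of `NS_ν(f_c)` (`ν > 0`) whose classical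
mean-zero kernel is contained in the complex line of a smooth divergence-free mean-zero real field `v`, and
for ONE first-order-visible coefficient direction `d` (`f_d ∉ range L(ν,u₀)`), there is a real correction
`σ` on `P_S × ℝ` with `σ (c, 0) = 0` which is continuous on a ball around `(c, 0)` and such that every
`q = (c', x)` in the ball carries a mean-zero classical steady state `u'` of the corrected force
`f_{c' − σ q • d}`, `H¹`-close to `u₀`, with `u' ≠ u₀` as soon as `x ≠ 0`.

Proof: run `LsFamily.stub_lsFamily` with the border field `h := f_d` (admissible by
`SteadyPersist.isSmooth_force'` / `isDivFree_force'` / `hasZeroMean_force'`); convert its corrected force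
`y ↦ f_{q.1} y − σ q • f_d y` into `f_{q.1 − σ q • d}` by real-linearity of `c ↦ f_c`
(`PeriodicPersistOfHenry.force_sub` and the homogeneity `force_smul'` below), and read `u' ≠ u₀` off the
phase condition `∫⟪v, u' − u₀⟫ = q.2`.  Pure proof file.
References: Chow–Hale 1982 §2.4 and Ch. 6; Vanderbauwhede 1982 Ch. 8; Kielhöfer 2012 §I.2.
-/

-- `Summit.<Summit>.<Problem>` is the tree's mandated summit-side namespace (CONVENTIONS §2); for this
-- single-conjunct summit the two coincide, so the duplicate is deliberate.
set_option linter.dupNamespace false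

noncomputable section

open scoped BigOperators Topology ENNReal NNReal InnerProductSpace ComplexConjugate
open Filter Set Function TopologicalSpace MeasureTheory UnitAddTorus

namespace Summit.AnomalousDissipation.AnomalousDissipation.Theorems.RobustLoudUpgrade.BorderedFamily

open Literature.Analysis.FunctionSpaces Literature.Analysis.FunctionSpaces.Torus
open Literature.Analysis.FunctionSpaces.EuclideanSpace
open Literature.Analysis.FluidPDE
open Summit.AnomalousDissipation.AnomalousDissipation.Theses.BaireTransfer
open Summit.AnomalousDissipation.AnomalousDissipation.Theorems.RobustLoudUpgrade.SteadyPersist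

variable {S : Finset (Fin 3 → ℤ)}

-- pattern from Cruxes/RobustLoudUpgrade/Disproof.lean §2 (`force_smul`) and
-- Literature/Analysis/FunctionSpaces/TorusWeightedGalerkinCoefficients.lean (`realTrigPoly_smul`)
/-- `c ↦ f_c` is `ℝ`-homogeneous. [folklore] -/
theorem force_smul' (a : ℝ) (c : Coeff S) : force S (a • c) = a • force S c := by
  have h : (fun k => Torus.lerayCoeff k (coeffExt S (a • c) k)) =
      (a : ℂ) • fun k => Torus.lerayCoeff k (coeffExt S c k) := by
    funext k
    rw [coeffExt_smul, Pi.smul_apply, Pi.smul_apply, ← SteadyLattice.lerayCoeff_smul', Complex.coe_smul]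
  unfold force
  rw [h]
  funext x
  rw [Pi.smul_apply, realTrigPoly_apply, realTrigPoly_apply, trigPoly_smul, Pi.smul_apply, Complex.coe_smul,
    map_smul]

/-- The corrected force of the family: `f_{c' − s • d} = f_{c'} − s • f_d` pointwise. [folklore] -/
theorem force_sub_smul (c' d : Coeff S) (s : ℝ) :
    force S (c' - s • d) = fun y => force S c' y - s • force S d y := by
  rw [PeriodicPersistOfHenry.force_sub, force_smul']
  rfl

/-- **Registered stub `stub_borderedFamily`: the bordered implicit family at a simply degenerate steady
state with one first-order-visible force direction** (Chow–Hale 1982 §2.4/Ch. 6, Vanderbauwhede 1982 Ch. 8,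
Kielhöfer 2012 §I.2) — the corollary of `LsFamily.stub_lsFamily` with border field `f_d`; see the module
docstring. [folklore] -/
theorem stub_borderedFamily : ∀ (S : Finset (Fin 3 → ℤ)) (c d : Coeff S) (ν : ℝ) (u₀ : UnitAddTorus (Fin 3) → EuclideanSpace ℝ (Fin 3)) (p₀ : UnitAddTorus (Fin 3) → ℝ) (v : UnitAddTorus (Fin 3) → EuclideanSpace ℝ (Fin 3)), 0 < ν → Torus.IsSteadyNSState ν (force S c) u₀ p₀ → HasZeroMean u₀ → IsSmooth v → IsDivFree v → HasZeroMean v → (∀ w, Torus.LinNSResolventRel ν u₀ 0 w 0 → ∃ z : ℂ, w = z • cplx v) → (∀ w, ¬ Torus.LinNSResolventRel ν u₀ 0 w (cplx (force S d))) → ∃ σ : Coeff S × ℝ → ℝ, σ (c, 0) = 0 ∧ ∀ δ : ℝ, 0 < δ → ∃ r : ℝ, 0 < r ∧ ContinuousOn σ (Metric.ball (c, (0 : ℝ)) r) ∧ ∀ q ∈ Metric.ball (c, (0 : ℝ)) r, ∃ (u' : UnitAddTorus (Fin 3) → EuclideanSpace ℝ (Fin 3)) (p' : UnitAddTorus (Fin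 3) → ℝ), Torus.IsSteadyNSState ν (force S (q.1 - σ q • d)) u' p' ∧ HasZeroMean u' ∧ h1DistSq u' u₀ < δ ∧ (q.2 ≠ 0 → u' ≠ u₀) := by
  intro S c d ν u₀ p₀ v hν hst h0 hv₁ hv₂ hv₃ hker hvis
  obtain ⟨σ, hσ0, -, hball, -⟩ := LsFamily.stub_lsFamily S c ν u₀ p₀ v (force S d) hν hst h0 hv₁ hv₂ hv₃
    hker (isSmooth_force' d) (isDivFree_force' d) (hasZeroMean_force' d) hvis
  refine ⟨σ, hσ0, fun δ hδ => ?_⟩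
  obtain ⟨r, hr, hcont, hq⟩ := hball δ hδ
  refine ⟨r, hr, hcont, fun q hqmem => ?_⟩
  obtain ⟨-, u', p', hst', hmean', hdist, -, hphase⟩ := hq q hqmem
  refine ⟨u', p', ?_, hmean', hdist, fun hx hu => hx ?_⟩
  · rw [force_sub_smul]
    exact hst'
  · rw [← hphase]
    subst hu
    simp

end Summit.AnomalousDissipation.AnomalousDissipation.Theorems.RobustLoudUpgrade.BorderedFamily
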